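import Literature.AlgebraicGeometry.HodgeTheory.HodgeTestFunctionalDifferentiable
import Literature.AlgebraicGeometry.HodgeTheory.HodgeFiltrationWedgeOrthogonal
import Literature.AlgebraicGeometry.HodgeTheory.TubeExtensionOfFibreForms
import Literature.AlgebraicGeometry.HodgeTheory.StandardModelTraceIntegral
import Literature.AlgebraicGeometry.HodgeTheory.PeriodsOfRelativeFormsHolomorphic
import Literature.Geometry.Kaehler.EhresmannChartBallTrivialisationInverse
import Literature.Analysis.Complex.DolbeaultInvariance
import HarnessLib

/-!
# The Hodge test functionals of a family over a chart ball: separation and differentiability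
# (Voisin I, proof of Thm. 10.9)

Topic: Hodge theory in families (Griffiths 1968; Voisin (2002), §10.1.2 Thm. 10.9, §7.1.2).
Theorems only, no definition, no named fact. Written by the prover seat `hodge-nonav-prover-Bx`
(g17, cell `hodge-nonav`) as brick **K5d** of the programme «GRIFFITHS-HOLOMORPHY» (memo
`PROGRAMME-GRIFFITHS-HOLOMORPHY-Bx-g17.md`, target
`Literature.AlgebraicGeometry.HodgeTheory.Griffiths1968_holomorphicHodgeSubbundlesQP`): the clause
`hdiff` of the frame theorem
`Literature.Analysis.Complex.exists_analyticOnNhd_frame_of_ker_of_differentiableAt` for the Hodge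
bundles `F^pH^k` of a proper holomorphic submersion, read on the fixed reference fibre.

SETTING (the output of `IsProperHolomorphicSubmersion.exists_chartBall_trivialisation_inverse`, taken
as hypotheses, exactly as in the companion bricks K0/K1 of `hodge-nonav-19716-p2`): a proper
holomorphic submersion `π : 𝒳 → B` with fibre models `ι b : X b ≅ 𝒳_b` over an open `O`, the
holomorphic chart `c` of `B` at `s₀`, the `C^∞` trivialisation `Φ : EB → X s₀ → 𝒳` of `𝒳` over the
chart ball `D = ball (c s₀) r` with its inverse chart `Λ : 𝒳 → EB × X s₀` (`Λ (Φ p x) = (p, x)`), and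
the fibre diffeomorphisms `e p : X s₀ ≃ X (c⁻¹ p)` with `ι (c⁻¹ p) ∘ e p = Φ p` (DEPENDENT on
`p ∈ D`). The reference fibre `M = X s₀` carries a smooth metric and an orientation `o₀` with
`vol_{o₀}` smooth (only used to norm `A^k(M; ℂ)` by `‖·‖_{L²}`); the fibre `X_z = X (c⁻¹ z)` over the
point `z ∈ D` under study carries a Kähler metric `g_z`, a continuous orientation `o_z` with smooth
volume form, compatible with `o₀` along `e z`, and satisfies Poincaré duality for the wedge pairing
(`hPD`, the hypothesis of `mem_hodgeFiltration_of_forall_cintegral_wedge_eq_zero`).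

RESULTS. For every closed `(m+1)`-form `β` on `X_z` (`k + (m+1) = dim_ℝ`) there is the **test
functional** `ℓ_β : H^k_dR(M; ℂ) → ℂ`, `ℓ_β [θ] = ∫_M θ ∧ (e z)^*β` (Stokes makes it well defined;
`exists_linearMap_mk_eq_cintegral_wedge`). Main theorem `exists_hodgeTestFunctionals_chartBall`:

* (sep) if `ℓ_β v = 0` for all closed `β ∈ F^{d-p+1}A^{m+1}(X_z)` (pointwise: all `(a,b)`-components
  with `a + p ≤ d` vanish), then `v ∈ (e z)^* F^pH^k(X_z)` — by the change of variables
  `∫_M (e z)^*(η ∧ β) = ∫_{X_z} η ∧ β` (`cintegral_pullback_eq`) and brick K4a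
  `mem_hodgeFiltration_of_forall_cintegral_wedge_eq_zero` on the Kähler fibre `X_z`;
* (diff) for such `β`, every map `σ : EB → H^k_dR(M; ℂ)` which, near `z`, is represented by an
  `L²`-continuous-at-`z` family `a(q) ∈ A^k(M; ℂ)` of the form `a(q) = (e q)^*η_q` with `η_q` a closed
  form on `X (c⁻¹ q)` lying pointwise in `F^p` (this is how brick K1 represents continuous sections
  of `F^pH^k` by transported harmonic representatives) has `q ↦ ℓ_β (σ q)` COMPLEX DIFFERENTIABLE at
  `z`. Proof (Voisin's, loc. cit.): with the retraction `ρ = e z ∘ pr₂ ∘ Λ` of the tube onto `X_z`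
  (`ρ ∘ Φ q = e z`), the tube extension `Ξ` of `β` (`exists_tubeExtension`: `Ξ = Π^{<p'}(ρ^*β)` near
  `X_z`, `p' = d + 1 - p`, so `ι_z^*Ξ = 0` and `dΞ ∈ F^{p'}` along `X_z`) satisfies
  `(e q)^*η ∧ Φ_q^*Ξ = (e q)^*η ∧ (e z)^*β` for `q` near `z` and every `η ∈ F^pA^k(X (c⁻¹ q))`
  (`exists_tubeTestForm_chartBall`), because `Φ_q^*(ρ^*β) = (e z)^*β` and
  `(e q)^*η ∧ Φ_q^*Π^{≥ p'}(ρ^*β) = (e q)^*(η ∧ ι_q^*Π^{≥p'}(ρ^*β)) = 0` for reasons of type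
  (`η ∈ F^p`, `ι_q` holomorphic, `p + p' > d`; `wedge_eq_zero_of_typeProjAt_eq_zero`); hence
  `∫_M a(q) ∧ Φ_q^*Ξ = ∫_M a(q) ∧ (e z)^*β = ℓ_β(σ q)` near `z`, and `q ↦ ∫_M a(q) ∧ Φ_q^*Ξ` is
  complex differentiable at `z` by brick K5c
  `differentiableAt_complex_cintegral_wedge_pullback_family_of_tendsto`, whose submersion-geometric
  hypotheses are discharged as in `PeriodsOfRelativeFormsHolomorphic`.

Honest scope: local differential geometry of a proper holomorphic submersion; nothing here says HC or
any rung is proved.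

## References

* C. Voisin, *Hodge Theory and Complex Algebraic Geometry I*, CUP (2002), §10.1.2 Thm. 10.9 and its
  proof in §10.2.2; §7.1.2. [VoisinHodgeI2002]
* P. Griffiths, Periods of integrals on algebraic manifolds II, Amer. J. Math. 90 (1968), Thm. 1.1.
  [Griffiths1968]
-/

noncomputable section

open scoped Manifold ContDiff Topology
open Bundle Set Function Filter Module Metric Complex Finset
open Literature.Geometry.Kaehler Literature.Geometry.Manifold Literature.NumberTheory.Transcendental
open Literature.AlgebraicGeometry.Motives Literature.Analysis.Complex

namespace Literature.AlgebraicGeometry.HodgeTheory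

-- The identification `TangentSpace I x = E` is an abuse of definitional equality; as in the
-- tree's form files we let `isDefEq` unfold it.
set_option backward.isDefEq.respectTransparency false

universe u

/-! ### The test functional `[θ] ↦ ∫_M θ ∧ γ` -/

section Functional

variable {E : Type*} [NormedAddCommGroup E] [NormedSpace ℂ E] [FiniteDimensional ℂ E]
  [MeasurableSpace E] [BorelSpace E]
  {M : Type*} [TopologicalSpace M] [ChartedSpace E M] [IsManifold 𝓘(ℝ, E) ∞ M]
  [T2Space M] [CompactSpace M] {n : ℕ} [Fact (finrank ℝ E = n)]
  (o : (x : M) → Orientation ℝ (TangentSpace 𝓘(ℝ, E) x) (Fin n))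

/-- **The wedge-pairing functional on de Rham cohomology**: for a closed smooth `l`-form `γ` on a
compact oriented `M` (`k + l = dim M`, `o` continuous) there is a `ℂ`-linear
`L : H^k_dR(M; ℂ) → ℂ` with `L [θ] = ∫_M θ ∧ γ` — well defined because `∫_M dτ ∧ γ = 0` by Stokes
(`cintegral_wedge_eq_zero_of_mem_cexactSmoothForms_left`). Voisin (2002), §7.1.2 (the pairing
`H^k × H^{2d-k} → ℂ`). [cite: VoisinHodgeI2002, §7.1.2] -/
theorem exists_linearMap_mk_eq_cintegral_wedge (ho : IsContinuousOrientation o) {k l : ℕ}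
    (h : k + l = n) (γ : cclosedSmoothForms E M l) :
    ∃ L : complexDeRhamCohomology E M k →ₗ[ℂ] ℂ, ∀ θ : cclosedSmoothForms E M k,
      L (complexDeRhamCohomology.mk E M k θ) =
        cintegral o (((θ : MForm 𝓘(ℝ, E) M ℂ k).wedge (γ : MForm 𝓘(ℝ, E) M ℂ l)).castDeg h) := by
  haveI : WedgeFacts 𝓘(ℝ, E) M ℂ := wedgeFacts_discharged _ _ ℂ
  have hγs : IsSmoothForm (γ : MForm 𝓘(ℝ, E) M ℂ l) := ((mem_cclosedSmoothForms_iff _).1 γ.2).1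
  have hγc : IsClosedForm (γ : MForm 𝓘(ℝ, E) M ℂ l) := ((mem_cclosedSmoothForms_iff _).1 γ.2).2
  have hsm : ∀ θ : cclosedSmoothForms E M k,
      IsSmoothForm ((((θ : MForm 𝓘(ℝ, E) M ℂ k).wedge (γ : MForm 𝓘(ℝ, E) M ℂ l))).castDeg h) :=
    fun θ ↦ isSmoothForm_castDeg h (isSmoothForm_wedge ((mem_cclosedSmoothForms_iff _).1 θ.2).1 hγs)
  let L₀ : cclosedSmoothForms E M k →ₗ[ℂ] ℂ :=
    { toFun := fun θ ↦
        cintegral o (((θ : MForm 𝓘(ℝ, E) M ℂ k).wedge (γ : MForm 𝓘(ℝ, E) M ℂ l)).castDeg h)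
      map_add' := fun θ₁ θ₂ ↦ by
        simp only [Submodule.coe_add, MForm.wedge_add_left, MForm.castDeg_add]
        exact HodgeRiemannDegreeOne.cintegral_add' o ho (hsm θ₁) (hsm θ₂)
      map_smul' := fun a θ ↦ by
        have hw1 : (a • (θ : MForm 𝓘(ℝ, E) M ℂ k)).wedge (γ : MForm 𝓘(ℝ, E) M ℂ l) =
            a • (θ : MForm 𝓘(ℝ, E) M ℂ k).wedge (γ : MForm 𝓘(ℝ, E) M ℂ l) := by
          funext x
          change (a • (show E [⋀^Fin k]→L[ℝ] ℂ from (θ : MForm 𝓘(ℝ, E) M ℂ k) x)).wedge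
              (show E [⋀^Fin l]→L[ℝ] ℂ from (γ : MForm 𝓘(ℝ, E) M ℂ l) x) =
            a • (show E [⋀^Fin k]→L[ℝ] ℂ from (θ : MForm 𝓘(ℝ, E) M ℂ k) x).wedge
              (show E [⋀^Fin l]→L[ℝ] ℂ from (γ : MForm 𝓘(ℝ, E) M ℂ l) x)
          exact wedge_smul_left_complex a _ _
        have hw : ((a • (θ : MForm 𝓘(ℝ, E) M ℂ k)).wedge (γ : MForm 𝓘(ℝ, E) M ℂ l)).castDeg h =
            a • (((θ : MForm 𝓘(ℝ, E) M ℂ k).wedge (γ : MForm 𝓘(ℝ, E) M ℂ l)).castDeg h) := by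
          rw [hw1]; rfl
        simp only [Submodule.coe_smul, RingHom.id_apply, hw, smul_eq_mul]
        exact HodgeRiemannDegreeOne.cintegral_smul' o ho a (hsm θ) }
  refine ⟨((cexactSmoothForms E M k).comap (cclosedSmoothForms E M k).subtype).liftQ L₀ ?_,
    fun θ ↦ rfl⟩
  intro θ hθ
  rw [LinearMap.mem_ker]
  exact cintegral_wedge_eq_zero_of_mem_cexactSmoothForms_left o ho h hθ hγs hγc

end Functional

/-! ### (sep): the joint kernel of the test functionals, transported along a diffeomorphism -/

section Separation

variable {E : Type*} [NormedAddCommGroup E] [NormedSpace ℂ E] [FiniteDimensional ℂ E]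
  [MeasurableSpace E] [BorelSpace E] {n : ℕ} [Fact (finrank ℝ E = n)]
  {M : Type*} [TopologicalSpace M] [ChartedSpace E M] [IsManifold 𝓘(ℝ, E) ∞ M]
  [T2Space M] [CompactSpace M]
  (o : (x : M) → Orientation ℝ (TangentSpace 𝓘(ℝ, E) x) (Fin n))
  {X : Type*} [TopologicalSpace X] [ChartedSpace E X] [IsManifold 𝓘(ℝ, E) ∞ X]
  [IsManifold 𝓘(ℂ, E) ω X] [T2Space X] [CompactSpace X]
  (g : ContMDiffRiemannianMetric 𝓘(ℝ, E) ∞ E (fun x : X ↦ TangentSpace 𝓘(ℝ, E) x))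
  (oX : (x : X) → Orientation ℝ (TangentSpace 𝓘(ℝ, E) x) (Fin n))

/-- **(sep) transported**: let `e : M ≃ X` be a diffeomorphism onto a compact Kähler `(X, g, o_X)`
(`o_X` continuous with smooth volume form, Poincaré duality `hPD` for the wedge pairing), compatible
with the orientation `o` of `M`. If a closed `k`-form `θ` on `M` satisfies `∫_M θ ∧ e^*β = 0` for every
closed `l`-form `β` on `X` all of whose `(a,b)`-components with `a + p ≤ d` vanish, then
`[θ] ∈ e^* F^pH^k(X)`. (Change of variables `cintegral_pullback_eq` + K4a
`mem_hodgeFiltration_of_forall_cintegral_wedge_eq_zero`.) Voisin (2002), §7.1.2.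
[cite: VoisinHodgeI2002, §7.1.2] -/
theorem mk_mem_map_hodgeFiltration_of_forall_cintegral_wedge_pullback_eq_zero
    (hg : g.toRiemannianMetric.IsKaehler)
    (hoX : IsContinuousOrientation oX) {k l : ℕ} (h : k + l = n) (p : ℕ)
    (hvol : letI : RiemannianBundle (fun x : X ↦ TangentSpace 𝓘(ℝ, E) x) := ⟨g.toRiemannianMetric⟩
      IsSmoothForm (riemannianVolumeForm oX))
    (hPD : ∀ θ : cclosedSmoothForms E X k, complexDeRhamCohomology.mk E X k θ ≠ 0 →
      ∃ γ : cclosedSmoothForms E X l,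
        cintegral oX (((θ : MForm 𝓘(ℝ, E) X ℂ k).wedge (γ : MForm 𝓘(ℝ, E) X ℂ l)).castDeg h) ≠ 0)
    (e : M ≃ₘ^∞⟮𝓘(ℝ, E), 𝓘(ℝ, E)⟯ X)
    (hoe : ∀ x, Orientation.map (Fin n) (e.mfderivToContinuousLinearEquiv (by simp) x).toLinearEquiv
      (o x) = oX (e x))
    (θ : cclosedSmoothForms E M k)
    (hθ : ∀ β : cclosedSmoothForms E X l,
      (∀ (y : X) (a b : ℕ), a + p ≤ finrank ℂ E →
        typeProjAt a b (show E [⋀^Fin l]→L[ℝ] ℂ from (β : MForm 𝓘(ℝ, E) X ℂ l) y) = 0) →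
      cintegral o (((θ : MForm 𝓘(ℝ, E) M ℂ k).wedge
        ((β : MForm 𝓘(ℝ, E) X ℂ l).pullback 𝓘(ℝ, E) e)).castDeg h) = 0) :
    complexDeRhamCohomology.mk E M k θ ∈
      (⨆ pq ∈ {pq ∈ antidiagonal k | p ≤ pq.1}, hodgePQ E X k pq.1 pq.2).map
        (complexDeRhamCohomology.map E e.contMDiff k) := by
  -- `η = (e⁻¹)^*θ` on `X`, with `e^*η = θ`
  have hed : MDifferentiable 𝓘(ℝ, E) 𝓘(ℝ, E) e := e.contMDiff.mdifferentiable (by simp)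
  have hesd : MDifferentiable 𝓘(ℝ, E) 𝓘(ℝ, E) e.symm := e.symm.contMDiff.mdifferentiable (by simp)
  set η : MForm 𝓘(ℝ, E) X ℂ k := (θ : MForm 𝓘(ℝ, E) M ℂ k).pullback 𝓘(ℝ, E) e.symm with hηdef
  have hηmem : η ∈ cclosedSmoothForms E X k :=
    pullback_mem_cclosedSmoothForms e.symm.contMDiff θ.2
  have hηθ : η.pullback 𝓘(ℝ, E) e = θ := by
    rw [hηdef, ← MForm.pullback_comp hesd hed]
    have : (e.symm : X → M) ∘ e = id := funext fun x ↦ e.symm_apply_apply x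
    rw [this, MForm.pullback_id]
  -- `[η] ∈ F^pH^k(X)` by K4a on the Kähler fibre
  have hηF : complexDeRhamCohomology.mk E X k ⟨η, hηmem⟩ ∈
      ⨆ pq ∈ {pq ∈ antidiagonal k | p ≤ pq.1}, hodgePQ E X k pq.1 pq.2 := by
    refine mem_hodgeFiltration_of_forall_cintegral_wedge_eq_zero oX g hg h p hoX hvol hPD ⟨η, hηmem⟩
      fun β hβ ↦ ?_
    haveI : WedgeFacts 𝓘(ℝ, E) X ℂ := wedgeFacts_discharged _ _ ℂ
    have hsm : IsSmoothForm (((η.wedge (β : MForm 𝓘(ℝ, E) X ℂ l))).castDeg h) :=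
      isSmoothForm_castDeg h (isSmoothForm_wedge ((mem_cclosedSmoothForms_iff _).1 hηmem).1
        ((mem_cclosedSmoothForms_iff _).1 β.2).1)
    have hcv := cintegral_pullback_eq o oX hoX e hoe hsm
    rw [← hcv, MForm.pullback_castDeg, MForm.pullback_wedge, hηθ]
    exact hθ β hβ
  -- transport: `[θ] = e^*[η]`
  have hmap : complexDeRhamCohomology.map E e.contMDiff k (complexDeRhamCohomology.mk E X k ⟨η, hηmem⟩) =
      complexDeRhamCohomology.mk E M k θ := by
    rw [complexDeRhamCohomology.map_mk]
    congr 1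
    exact Subtype.ext hηθ
  rw [← hmap]
  exact Submodule.mem_map_of_mem hηF

end Separation

/-! ### The main theorem over a chart ball -/

section ChartBall

variable {EX : Type u} [NormedAddCommGroup EX] [NormedSpace ℂ EX] [FiniteDimensional ℂ EX]
  [MeasurableSpace EX] [BorelSpace EX] {N : ℕ} [Fact (finrank ℝ EX = N)]
  {E𝒳 : Type u} [NormedAddCommGroup E𝒳] [NormedSpace ℂ E𝒳] [FiniteDimensional ℂ E𝒳]
  {𝒳 : Type u} [TopologicalSpace 𝒳] [ChartedSpace E𝒳 𝒳] [IsManifold 𝓘(ℂ, E𝒳) ω 𝒳]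
  [IsManifold 𝓘(ℝ, E𝒳) ∞ 𝒳] [T2Space 𝒳] [NormalSpace 𝒳] [SigmaCompactSpace 𝒳]
  {EB : Type u} [NormedAddCommGroup EB] [NormedSpace ℂ EB] [FiniteDimensional ℂ EB]
  {B : Type u} [TopologicalSpace B] [ChartedSpace EB B] [IsManifold 𝓘(ℂ, EB) ω B]
  {ϖ : 𝒳 → B}

omit [MeasurableSpace EX] [BorelSpace EX] [FiniteDimensional ℂ EB] [IsManifold 𝓘(ℂ, EB) ω B] in
/-- **The tube test form of a closed `F^{d-p+1}`-form on a fibre** (Voisin (2002), §10.2.2, the form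
`Ξ` of the proof of Thm. 10.9, in the chart-ball setting of the module docstring): for a closed
`(m+1)`-form `β` on the fibre `X_z = X (c⁻¹ z)` all of whose `(a,b)`-components with `a + p ≤ d` vanish,
there is a smooth `(m+1)`-form `Ξ` on the total space with `ι_z^*Ξ = 0`, `dΞ ∈ F^{d+1-p}` along
`X_z`, and such that for `q` near `z` and EVERY `k`-form `η` on `X (c⁻¹ q)` lying pointwise in `F^p`,
`(e q)^*η ∧ Φ_q^*Ξ = (e q)^*η ∧ (e z)^*β` on the reference fibre. (`Ξ = Π^{<d+1-p}(ρ^*β)` near `X_z`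
for the retraction `ρ = e z ∘ pr₂ ∘ Λ`, `exists_tubeExtension`; the difference `Φ_q^*Π^{≥ d+1-p}(ρ^*β)`
wedges to zero against `(e q)^*η` for reasons of type, `wedge_eq_zero_of_typeProjAt_eq_zero`.)
[cite: VoisinHodgeI2002, §10.2.2 (proof of Thm. 10.9)] -/
theorem exists_tubeTestForm_chartBall
    (hπ : IsProperHolomorphicSubmersion E𝒳 EB ϖ) {O : Set B} {s₀ : B}
    {X : B → Type u} [∀ b, TopologicalSpace (X b)] [∀ b, ChartedSpace EX (X b)]
    [∀ b, IsManifold 𝓘(ℂ, EX) ω (X b)] [∀ b, IsManifold 𝓘(ℝ, EX) ∞ (X b)]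
    [∀ b, CompactSpace (X b)] [∀ b, T2Space (X b)] {ι : ∀ b, X b → 𝒳}
    (hι : ∀ b ∈ O, IsFibreEmbedding EX E𝒳 ϖ b (ι b))
    {r : ℝ} {Φ : EB → X s₀ → 𝒳} {Λ : 𝒳 → EB × X s₀}
    (hbt : ball (extChartAt 𝓘(ℂ, EB) s₀ s₀) r ⊆ (extChartAt 𝓘(ℂ, EB) s₀).target)
    (hbO : ∀ p ∈ ball (extChartAt 𝓘(ℂ, EB) s₀ s₀) r, (extChartAt 𝓘(ℂ, EB) s₀).symm p ∈ O)
    (hΦs : ContMDiffOn (𝓘(ℝ, EB).prod 𝓘(ℝ, EX)) 𝓘(ℝ, E𝒳) ∞ (uncurry Φ)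
      (ball (extChartAt 𝓘(ℂ, EB) s₀ s₀) r ×ˢ univ))
    (e : ∀ p ∈ ball (extChartAt 𝓘(ℂ, EB) s₀ s₀) r,
      X s₀ ≃ₘ^∞⟮𝓘(ℝ, EX), 𝓘(ℝ, EX)⟯ X ((extChartAt 𝓘(ℂ, EB) s₀).symm p))
    (he : ∀ p (hp : p ∈ ball (extChartAt 𝓘(ℂ, EB) s₀ s₀) r), ∀ x,
      ι ((extChartAt 𝓘(ℂ, EB) s₀).symm p) (e p hp x) = Φ p x)
    (hΛs : ContMDiffOn 𝓘(ℝ, E𝒳) (𝓘(ℝ, EB).prod 𝓘(ℝ, EX)) ∞ Λ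
      (ϖ ⁻¹' ((extChartAt 𝓘(ℂ, EB) s₀).symm '' ball (extChartAt 𝓘(ℂ, EB) s₀ s₀) r)))
    (hΛΦ : ∀ p ∈ ball (extChartAt 𝓘(ℂ, EB) s₀ s₀) r, ∀ x, Λ (Φ p x) = (p, x))
    {z : EB} (hz : z ∈ ball (extChartAt 𝓘(ℂ, EB) s₀ s₀) r) {k m : ℕ} (p : ℕ)
    (β : cclosedSmoothForms EX (X ((extChartAt 𝓘(ℂ, EB) s₀).symm z)) (m + 1))
    (hβF : ∀ (y : X ((extChartAt 𝓘(ℂ, EB) s₀).symm z)) (a b : ℕ), a + p ≤ finrank ℂ EX →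
      typeProjAt a b (show EX [⋀^Fin (m + 1)]→L[ℝ] ℂ from
        (β : MForm 𝓘(ℝ, EX) (X ((extChartAt 𝓘(ℂ, EB) s₀).symm z)) ℂ (m + 1)) y) = 0) :
    ∃ Ξ : MForm 𝓘(ℝ, E𝒳) 𝒳 ℂ (m + 1), IsSmoothForm Ξ ∧
      Ξ.pullback 𝓘(ℝ, EX) (ι ((extChartAt 𝓘(ℂ, EB) s₀).symm z)) = 0 ∧
      (∀ (x : X s₀) (r' s : ℕ), r' < finrank ℂ EX + 1 - p →
        typeProjAt r' s (show E𝒳 [⋀^Fin (m + 1 + 1)]→L[ℝ] ℂ from mextDeriv Ξ (Φ z x)) = 0) ∧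
      ∀ᶠ q in 𝓝 z, ∃ hq : q ∈ ball (extChartAt 𝓘(ℂ, EB) s₀ s₀) r,
        ∀ η : MForm 𝓘(ℝ, EX) (X ((extChartAt 𝓘(ℂ, EB) s₀).symm q)) ℂ k,
          (∀ (y : X ((extChartAt 𝓘(ℂ, EB) s₀).symm q)) (r' s : ℕ), r' < p →
            typeProjAt r' s (show EX [⋀^Fin k]→L[ℝ] ℂ from η y) = 0) →
          (η.pullback 𝓘(ℝ, EX) (e q hq)).wedge (Ξ.pullback 𝓘(ℝ, EX) (Φ q)) =
            (η.pullback 𝓘(ℝ, EX) (e q hq)).wedge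
              ((β : MForm 𝓘(ℝ, EX) (X ((extChartAt 𝓘(ℂ, EB) s₀).symm z)) ℂ (m + 1)).pullback
                𝓘(ℝ, EX) (e z hz)) := by
  have hb : (extChartAt 𝓘(ℂ, EB) s₀).symm z ∈ O := hbO z hz
  have hιb := hι _ hb
  let ez := e z hz
  have hez : ez = e z hz := rfl
  haveI : WedgeFacts 𝓘(ℝ, EX) (X s₀) ℂ := wedgeFacts_discharged _ _ ℂ
  have hU : IsOpen (ball (extChartAt 𝓘(ℂ, EB) s₀ s₀) r) := isOpen_ball
  have hΨ : ∀ q ∈ ball (extChartAt 𝓘(ℂ, EB) s₀ s₀) r, ∀ x,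
      ContMDiffAt (𝓘(ℝ, EB).prod 𝓘(ℝ, EX)) 𝓘(ℝ, E𝒳) ∞ (uncurry Φ) (q, x) := fun q hq x ↦
    (hΦs (q, x) ⟨hq, mem_univ x⟩).contMDiffAt ((hU.prod isOpen_univ).mem_nhds ⟨hq, mem_univ x⟩)
  have hΦq : ∀ q ∈ ball (extChartAt 𝓘(ℂ, EB) s₀ s₀) r, ContMDiff 𝓘(ℝ, EX) 𝓘(ℝ, E𝒳) ∞ (Φ q) := fun q hq x ↦
    ((hΨ q hq x).comp x (contMDiffAt_const.prodMk contMDiffAt_id)).of_le le_rfl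
  -- the tube `W = ϖ⁻¹(c⁻¹ D)` and the retraction `ρ = e z ∘ pr₂ ∘ Λ`
  let W : Set 𝒳 := ϖ ⁻¹' ((extChartAt 𝓘(ℂ, EB) s₀).symm '' ball (extChartAt 𝓘(ℂ, EB) s₀ s₀) r)
  have hWo : IsOpen W := by
    have h1 : IsOpen ((extChartAt 𝓘(ℂ, EB) s₀).symm '' ball (extChartAt 𝓘(ℂ, EB) s₀ s₀) r) := by
      rw [PartialEquiv.symm_image_eq_source_inter_preimage (e := extChartAt 𝓘(ℂ, EB) s₀) hbt]
      exact isOpen_extChartAt_preimage' (I := 𝓘(ℂ, EB)) s₀ isOpen_ball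
    exact h1.preimage hπ.contMDiff.continuous
  let ρ : 𝒳 → X ((extChartAt 𝓘(ℂ, EB) s₀).symm z) := fun y ↦ ez (Λ y).2
  have hρs : ∀ y ∈ W, ContMDiffAt 𝓘(ℝ, E𝒳) 𝓘(ℝ, EX) ∞ ρ y := fun y hy ↦ by
    have hΛy : ContMDiffAt 𝓘(ℝ, E𝒳) (𝓘(ℝ, EB).prod 𝓘(ℝ, EX)) ∞ Λ y :=
      (hΛs y hy).contMDiffAt (hWo.mem_nhds hy)
    exact ez.contMDiff.contMDiffAt.comp y (contMDiffAt_snd.comp y hΛy)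
  have hρι : ∀ x', ρ (ι ((extChartAt 𝓘(ℂ, EB) s₀).symm z) x') = x' := fun x' ↦ by
    obtain ⟨x, rfl⟩ := ez.surjective x'
    change ez (Λ (ι ((extChartAt 𝓘(ℂ, EB) s₀).symm z) (ez x))).2 = ez x
    rw [hez, he z hz x, hΛΦ z hz x]
  have hρΦ : ∀ q ∈ ball (extChartAt 𝓘(ℂ, EB) s₀ s₀) r, ∀ x, ρ (Φ q x) = ez x := fun q hq x ↦ by
    change ez (Λ (Φ q x)).2 = ez x
    rw [hΛΦ q hq x]
  -- the tube extension `Ξ` of `β`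
  let p₀ : ℕ := finrank ℂ EX + 1 - p
  have hp₀ : p₀ = finrank ℂ EX + 1 - p := rfl
  have hβs : IsSmoothForm (β : MForm 𝓘(ℝ, EX) (X ((extChartAt 𝓘(ℂ, EB) s₀).symm z)) ℂ (m + 1)) :=
    ((mem_cclosedSmoothForms_iff _).1 β.2).1
  have hβc : IsClosedForm (β : MForm 𝓘(ℝ, EX) (X ((extChartAt 𝓘(ℂ, EB) s₀).symm z)) ℂ (m + 1)) :=
    ((mem_cclosedSmoothForms_iff _).1 β.2).2
  have hβT : ∀ r' s, r' < p₀ →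
      (β : MForm 𝓘(ℝ, EX) (X ((extChartAt 𝓘(ℂ, EB) s₀).symm z)) ℂ (m + 1)).typeComponent r' s = 0 := by
    intro r' s hrs
    funext y
    rw [typeComponent_apply']
    exact hβF y r' s (by omega)
  have hιzℂ : MDifferentiable 𝓘(ℂ, EX) 𝓘(ℂ, E𝒳) (ι ((extChartAt 𝓘(ℂ, EB) s₀).symm z)) :=
    hιb.contMDiff.mdifferentiable (by simp)
  have hιW : range (ι ((extChartAt 𝓘(ℂ, EB) s₀).symm z)) ⊆ W := by
    rintro _ ⟨x', rfl⟩
    change ϖ (ι ((extChartAt 𝓘(ℂ, EB) s₀).symm z) x') ∈ (extChartAt 𝓘(ℂ, EB) s₀).symm '' ball (extChartAt 𝓘(ℂ, EB) s₀ s₀) r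
    rw [hιb.apply_eq]
    exact ⟨z, hz, rfl⟩
  obtain ⟨Ξ, hΞs, hΞι, hdΞ, W₁, hW₁o, hιW₁, hW₁W, hΞW₁⟩ :=
    exists_tubeExtension (T := 𝒳) (M := X ((extChartAt 𝓘(ℂ, EB) s₀).symm z)) hιzℂ hWo hιW hρs hρι hβs hβc hβT
  refine ⟨Ξ, hΞs, hΞι, fun x r' s hrs ↦ by rw [← he z hz x]; exact hdΞ (ez x) r' s hrs, ?_⟩
  -- `Φ q` maps into `W₁` for `q` near `z`
  have hW₁ev : ∀ᶠ q in 𝓝 z, ∀ x, Φ q x ∈ W₁ := by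
    have hK' := (isCompact_univ : IsCompact (univ : Set (X s₀))).eventually_forall_of_forall_eventually
      (x₀ := z) (P := fun q x ↦ Φ q x ∈ W₁) fun x _ ↦ ?_
    · exact hK'.mono fun q hq x ↦ hq x (mem_univ x)
    have hcont : ContinuousAt (uncurry Φ) (z, x) := (hΨ z hz x).continuousAt
    have hzx : uncurry Φ (z, x) ∈ W₁ := hιW₁ ⟨ez x, by simp only [uncurry, hez, he z hz x]⟩
    exact hcont.preimage_mem_nhds (hW₁o.mem_nhds hzx)
  filter_upwards [hW₁ev, hU.mem_nhds hz] with q hqW hqD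
  refine ⟨hqD, fun η hηF ↦ ?_⟩
  -- the high part `Θ = Π^{≥ p₀}(ρ^*β)` and the splitting `ρ^*β = Ξ + Θ` on `W₁`
  obtain ⟨Θ, hΘ⟩ : ∃ Θ : MForm 𝓘(ℝ, E𝒳) 𝒳 ℂ (m + 1), Θ =
      ∑ pq ∈ (Finset.HasAntidiagonal.antidiagonal (m + 1)).filter (fun pq ↦ ¬ pq.1 < p₀),
        ((β : MForm 𝓘(ℝ, EX) (X ((extChartAt 𝓘(ℂ, EB) s₀).symm z)) ℂ (m + 1)).pullback
          𝓘(ℝ, E𝒳) ρ).typeComponent pq.1 pq.2 := ⟨_, rfl⟩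
  have hsum := sum_antidiagonal_typeComponent_holds (E := E𝒳) (M := 𝒳) (k := m + 1)
    ((β : MForm 𝓘(ℝ, EX) (X ((extChartAt 𝓘(ℂ, EB) s₀).symm z)) ℂ (m + 1)).pullback 𝓘(ℝ, E𝒳) ρ)
  rw [← Finset.sum_filter_add_sum_filter_not (Finset.HasAntidiagonal.antidiagonal (m + 1)) (fun pq ↦ pq.1 < p₀)]
    at hsum
  have hΞy : ∀ y ∈ W₁, Ξ y + Θ y =
      ((β : MForm 𝓘(ℝ, EX) (X ((extChartAt 𝓘(ℂ, EB) s₀).symm z)) ℂ (m + 1)).pullback 𝓘(ℝ, E𝒳) ρ) y := by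
    intro y hy
    have h := congr_fun hsum y
    rw [← hΘ] at h
    rw [Pi.add_apply, Finset.sum_apply] at h
    rw [hΞW₁ y hy]
    exact h
  -- `Φ_q^*Ξ + Φ_q^*Θ = (e z)^*β` pointwise
  have hZ : ∀ x, (Ξ.pullback 𝓘(ℝ, EX) (Φ q)) x + (Θ.pullback 𝓘(ℝ, EX) (Φ q)) x =
      ((β : MForm 𝓘(ℝ, EX) (X ((extChartAt 𝓘(ℂ, EB) s₀).symm z)) ℂ (m + 1)).pullback 𝓘(ℝ, EX) ez) x := by
    intro x
    have hy := hqW x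
    have hρd : MDifferentiableAt 𝓘(ℝ, E𝒳) 𝓘(ℝ, EX) ρ (Φ q x) :=
      (hρs _ (hW₁W hy)).mdifferentiableAt (by simp)
    have hΦd : MDifferentiableAt 𝓘(ℝ, EX) 𝓘(ℝ, E𝒳) (Φ q) x :=
      (hΦq q hqD x).mdifferentiableAt (by simp)
    have h1 : (((β : MForm 𝓘(ℝ, EX) (X ((extChartAt 𝓘(ℂ, EB) s₀).symm z)) ℂ (m + 1)).pullback
        𝓘(ℝ, E𝒳) ρ).pullback 𝓘(ℝ, EX) (Φ q)) x =
        ((β : MForm 𝓘(ℝ, EX) (X ((extChartAt 𝓘(ℂ, EB) s₀).symm z)) ℂ (m + 1)).pullback 𝓘(ℝ, EX) ez) x := by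
      have h1' : (((β : MForm 𝓘(ℝ, EX) (X ((extChartAt 𝓘(ℂ, EB) s₀).symm z)) ℂ (m + 1)).pullback
          𝓘(ℝ, E𝒳) ρ).pullback 𝓘(ℝ, EX) (Φ q)) x =
          ((β : MForm 𝓘(ℝ, EX) (X ((extChartAt 𝓘(ℂ, EB) s₀).symm z)) ℂ (m + 1)).pullback
            𝓘(ℝ, EX) (ρ ∘ Φ q)) x := by
        ext v
        simp only [MForm.pullback_apply, Function.comp_apply, mfderiv_comp x hρd hΦd,
          ContinuousLinearMap.coe_comp]
      rw [h1']
      have hfun : ρ ∘ Φ q = ez := funext fun x' ↦ hρΦ q hqD x'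
      rw [hfun]
    rw [← h1]
    ext v
    have h3 := congrArg
      (fun L : TangentSpace 𝓘(ℝ, E𝒳) (Φ q x) [⋀^Fin (m + 1)]→L[ℝ] ℂ ↦
        L (fun i ↦ mfderiv 𝓘(ℝ, EX) 𝓘(ℝ, E𝒳) (Φ q) x (v i))) (hΞy _ hy)
    simpa only [ContinuousAlternatingMap.add_apply, MForm.pullback_apply] using h3
  -- `a(q) ∧ Φ_q^*Θ = (e q)^*(η_q ∧ ι_q^*Θ) = 0` for reasons of type
  have hkill : ((η.pullback 𝓘(ℝ, EX) (e q hqD))).wedge (Θ.pullback 𝓘(ℝ, EX) (Φ q)) = 0 := by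
    have hιq := hι _ (hbO q hqD)
    have hιqℂ : MDifferentiable 𝓘(ℂ, EX) 𝓘(ℂ, E𝒳) (ι ((extChartAt 𝓘(ℂ, EB) s₀).symm q)) :=
      hιq.contMDiff.mdifferentiable (by simp)
    have hιqd : MDifferentiable 𝓘(ℝ, EX) 𝓘(ℝ, E𝒳) (ι ((extChartAt 𝓘(ℂ, EB) s₀).symm q)) := hιqℂ.real_of_complex
    have heqd : MDifferentiable 𝓘(ℝ, EX) 𝓘(ℝ, EX) (e q hqD) :=
      (e q hqD).contMDiff.mdifferentiable (by simp)
    have hΦfac : Φ q = ι ((extChartAt 𝓘(ℂ, EB) s₀).symm q) ∘ e q hqD := funext fun x ↦ (he q hqD x).symm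
    obtain ⟨Θq, hΘq⟩ : ∃ Θq : MForm 𝓘(ℝ, EX) (X ((extChartAt 𝓘(ℂ, EB) s₀).symm q)) ℂ (m + 1),
        Θq = Θ.pullback 𝓘(ℝ, EX) (ι ((extChartAt 𝓘(ℂ, EB) s₀).symm q)) := ⟨_, rfl⟩
    have hΘq' : Θq = ∑ pq ∈ (Finset.HasAntidiagonal.antidiagonal (m + 1)).filter (fun pq ↦ ¬ pq.1 < p₀),
        ((((β : MForm 𝓘(ℝ, EX) (X ((extChartAt 𝓘(ℂ, EB) s₀).symm z)) ℂ (m + 1)).pullback 𝓘(ℝ, E𝒳) ρ).pullback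
          𝓘(ℝ, EX) (ι ((extChartAt 𝓘(ℂ, EB) s₀).symm q))).typeComponent pq.1 pq.2) := by
      rw [hΘq, hΘ, ← MForm.cpullbackₗ_apply, map_sum]
      refine Finset.sum_congr rfl fun pq _ ↦ ?_
      rw [MForm.cpullbackₗ_apply, typeComponent_pullback _ _ _ hιqℂ]
    have hΘqT : ∀ y r' s, r' < p₀ →
        typeProjAt r' s (show EX [⋀^Fin (m + 1)]→L[ℝ] ℂ from Θq y) = 0 := by
      intro y r' s hrs
      rw [hΘq', Finset.sum_apply, ← typeProjₗ_apply, map_sum]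
      refine Finset.sum_eq_zero fun pq hpq ↦ ?_
      rw [Finset.mem_filter, Finset.HasAntidiagonal.mem_antidiagonal] at hpq
      rw [typeProjₗ_apply, typeComponent_apply']
      exact (isOfTypeAt_typeProjAt hpq.1 _).typeProjAt_of_ne (Or.inl (by omega))
    have hw0 : η.wedge Θq = 0 := by
      funext y
      change (show EX [⋀^Fin k]→L[ℝ] ℂ from η y).wedge
        (show EX [⋀^Fin (m + 1)]→L[ℝ] ℂ from Θq y) = 0
      exact wedge_eq_zero_of_typeProjAt_eq_zero (p₀ := p₀)
        (fun a' b hab ↦ hηF y a' b (by omega)) (fun r' s hrs ↦ hΘqT y r' s hrs)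
    rw [hΦfac, MForm.pullback_comp hιqd heqd, ← hΘq, ← MForm.pullback_wedge, hw0,
      MForm.pullback_zero]
  -- pointwise: `a(q)_x ∧ ((e z)^*β)_x = a(q)_x ∧ (Φ_q^*Ξ)_x`
  have hpt : ∀ x : X s₀, (show EX [⋀^Fin k]→L[ℝ] ℂ from (η.pullback 𝓘(ℝ, EX) (e q hqD)) x).wedge
        (show EX [⋀^Fin (m + 1)]→L[ℝ] ℂ from
          ((β : MForm 𝓘(ℝ, EX) (X ((extChartAt 𝓘(ℂ, EB) s₀).symm z)) ℂ (m + 1)).pullback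
            𝓘(ℝ, EX) ez) x) =
      (show EX [⋀^Fin k]→L[ℝ] ℂ from (η.pullback 𝓘(ℝ, EX) (e q hqD)) x).wedge
        (show EX [⋀^Fin (m + 1)]→L[ℝ] ℂ from (Ξ.pullback 𝓘(ℝ, EX) (Φ q)) x) := by
    intro x
    have hk0 : (show EX [⋀^Fin k]→L[ℝ] ℂ from (η.pullback 𝓘(ℝ, EX) (e q hqD)) x).wedge
        (show EX [⋀^Fin (m + 1)]→L[ℝ] ℂ from (Θ.pullback 𝓘(ℝ, EX) (Φ q)) x) = 0 :=
      congr_fun hkill x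
    rw [← hZ x, ContinuousAlternatingMap.wedge_add_right (V := EX), hk0, add_zero]
  exact funext fun x ↦ (hpt x).symm

/-- **The Hodge test functionals over a chart ball: separation and differentiability** (Voisin
(2002), proof of Thm. 10.9; statement and proof in the module docstring). Setting: the output of
`IsProperHolomorphicSubmersion.exists_chartBall_trivialisation_inverse` as hypotheses (chart ball
`D = ball (c s₀) r`, trivialisation `Φ`, inverse chart `Λ`, fibre diffeomorphisms `e p`, `p ∈ D`), a
smooth metric and an orientation `o₀` with smooth volume form on the reference fibre `X s₀`, and on
the fibre `X (c⁻¹ z)` over the point `z ∈ D`: a Kähler metric `g_z`, a continuous orientation `o_z`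
with smooth volume form compatible with `o₀` along `e z`, and Poincaré duality `hPD` for the wedge
pairing in degrees `k + (m+1) = dim_ℝ`. Conclusion: test functionals `ℓ_β [θ] = ∫ θ ∧ (e z)^*β`
(`β` closed on `X (c⁻¹ z)`) with (sep) joint kernel over `β ∈ F^{d-p+1}` inside `(e z)^*F^pH^k` and
(diff) `q ↦ ℓ_β (σ q)` complex differentiable at `z` for every `σ` represented near `z` by an
`L²`-continuous family of transported `F^p`-representatives.
[cite: VoisinHodgeI2002, §10.2.2 (proof of Thm. 10.9)] [cite: VoisinHodgeI2002, §7.1.2] -/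
theorem exists_hodgeTestFunctionals_chartBall
    (hπ : IsProperHolomorphicSubmersion E𝒳 EB ϖ) {O : Set B} {s₀ : B}
    {X : B → Type u} [∀ b, TopologicalSpace (X b)] [∀ b, ChartedSpace EX (X b)]
    [∀ b, IsManifold 𝓘(ℂ, EX) ω (X b)] [∀ b, IsManifold 𝓘(ℝ, EX) ∞ (X b)]
    [∀ b, CompactSpace (X b)] [∀ b, T2Space (X b)] {ι : ∀ b, X b → 𝒳}
    (hι : ∀ b ∈ O, IsFibreEmbedding EX E𝒳 ϖ b (ι b))
    (hdim : finrank ℂ EX + finrank ℂ EB = finrank ℂ E𝒳)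
    [RiemannianBundle (fun x : X s₀ ↦ TangentSpace 𝓘(ℝ, EX) x)]
    [IsContMDiffRiemannianBundle 𝓘(ℝ, EX) ∞ EX (fun x : X s₀ ↦ TangentSpace 𝓘(ℝ, EX) x)]
    (o₀ : (x : X s₀) → Orientation ℝ (TangentSpace 𝓘(ℝ, EX) x) (Fin N))
    (hov₀ : IsSmoothForm (riemannianVolumeForm o₀))
    {r : ℝ} {Φ : EB → X s₀ → 𝒳} {Λ : 𝒳 → EB × X s₀}
    (hbt : ball (extChartAt 𝓘(ℂ, EB) s₀ s₀) r ⊆ (extChartAt 𝓘(ℂ, EB) s₀).target)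
    (hbO : ∀ p ∈ ball (extChartAt 𝓘(ℂ, EB) s₀ s₀) r, (extChartAt 𝓘(ℂ, EB) s₀).symm p ∈ O)
    (hπΦ : ∀ p ∈ ball (extChartAt 𝓘(ℂ, EB) s₀ s₀) r, ∀ x,
      ϖ (Φ p x) = (extChartAt 𝓘(ℂ, EB) s₀).symm p)
    (hΦs : ContMDiffOn (𝓘(ℝ, EB).prod 𝓘(ℝ, EX)) 𝓘(ℝ, E𝒳) ∞ (uncurry Φ)
      (ball (extChartAt 𝓘(ℂ, EB) s₀ s₀) r ×ˢ univ))
    (e : ∀ p ∈ ball (extChartAt 𝓘(ℂ, EB) s₀ s₀) r,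
      X s₀ ≃ₘ^∞⟮𝓘(ℝ, EX), 𝓘(ℝ, EX)⟯ X ((extChartAt 𝓘(ℂ, EB) s₀).symm p))
    (he : ∀ p (hp : p ∈ ball (extChartAt 𝓘(ℂ, EB) s₀ s₀) r), ∀ x,
      ι ((extChartAt 𝓘(ℂ, EB) s₀).symm p) (e p hp x) = Φ p x)
    (hΛs : ContMDiffOn 𝓘(ℝ, E𝒳) (𝓘(ℝ, EB).prod 𝓘(ℝ, EX)) ∞ Λ
      (ϖ ⁻¹' ((extChartAt 𝓘(ℂ, EB) s₀).symm '' ball (extChartAt 𝓘(ℂ, EB) s₀ s₀) r)))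
    (hΛΦ : ∀ p ∈ ball (extChartAt 𝓘(ℂ, EB) s₀ s₀) r, ∀ x, Λ (Φ p x) = (p, x))
    {z : EB} (hz : z ∈ ball (extChartAt 𝓘(ℂ, EB) s₀ s₀) r)
    (gz : ContMDiffRiemannianMetric 𝓘(ℝ, EX) ∞ EX
      (fun x : X ((extChartAt 𝓘(ℂ, EB) s₀).symm z) ↦ TangentSpace 𝓘(ℝ, EX) x))
    (hgz : gz.toRiemannianMetric.IsKaehler)
    (oz : (x : X ((extChartAt 𝓘(ℂ, EB) s₀).symm z)) →
      Orientation ℝ (TangentSpace 𝓘(ℝ, EX) x) (Fin N))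
    (hozc : IsContinuousOrientation oz)
    (hozv : letI : RiemannianBundle (fun x : X ((extChartAt 𝓘(ℂ, EB) s₀).symm z) ↦
        TangentSpace 𝓘(ℝ, EX) x) := ⟨gz.toRiemannianMetric⟩
      IsSmoothForm (riemannianVolumeForm oz))
    (hoe : ∀ x, Orientation.map (Fin N)
      ((e z hz).mfderivToContinuousLinearEquiv (by simp) x).toLinearEquiv (o₀ x) = oz (e z hz x))
    {k m : ℕ} (hkm : k + (m + 1) = N) (p : ℕ)
    (hPD : ∀ θ : cclosedSmoothForms EX (X ((extChartAt 𝓘(ℂ, EB) s₀).symm z)) k,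
      complexDeRhamCohomology.mk EX (X ((extChartAt 𝓘(ℂ, EB) s₀).symm z)) k θ ≠ 0 →
      ∃ γ : cclosedSmoothForms EX (X ((extChartAt 𝓘(ℂ, EB) s₀).symm z)) (m + 1),
        cintegral oz (((θ : MForm 𝓘(ℝ, EX) (X ((extChartAt 𝓘(ℂ, EB) s₀).symm z)) ℂ k).wedge
          (γ : MForm 𝓘(ℝ, EX) (X ((extChartAt 𝓘(ℂ, EB) s₀).symm z)) ℂ (m + 1))).castDeg hkm) ≠ 0) :
    haveI : Fact (IsSmoothForm (riemannianVolumeForm o₀)) := ⟨hov₀⟩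
    ∃ ℓ : cclosedSmoothForms EX (X ((extChartAt 𝓘(ℂ, EB) s₀).symm z)) (m + 1) →
        (complexDeRhamCohomology EX (X s₀) k →ₗ[ℂ] ℂ),
      (∀ β (θ : cclosedSmoothForms EX (X s₀) k),
        ℓ β (complexDeRhamCohomology.mk EX (X s₀) k θ) =
          cintegral o₀ (((θ : MForm 𝓘(ℝ, EX) (X s₀) ℂ k).wedge
            ((β : MForm 𝓘(ℝ, EX) (X ((extChartAt 𝓘(ℂ, EB) s₀).symm z)) ℂ (m + 1)).pullback
              𝓘(ℝ, EX) (e z hz))).castDeg hkm)) ∧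
      (∀ v : complexDeRhamCohomology EX (X s₀) k,
        (∀ β : cclosedSmoothForms EX (X ((extChartAt 𝓘(ℂ, EB) s₀).symm z)) (m + 1),
          (∀ (y : X ((extChartAt 𝓘(ℂ, EB) s₀).symm z)) (a b : ℕ), a + p ≤ finrank ℂ EX →
            typeProjAt a b (show EX [⋀^Fin (m + 1)]→L[ℝ] ℂ from
              (β : MForm 𝓘(ℝ, EX) (X ((extChartAt 𝓘(ℂ, EB) s₀).symm z)) ℂ (m + 1)) y) = 0) →
          ℓ β v = 0) →
        v ∈ (⨆ pq ∈ {pq ∈ antidiagonal k | p ≤ pq.1},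
              hodgePQ EX (X ((extChartAt 𝓘(ℂ, EB) s₀).symm z)) k pq.1 pq.2).map
            (complexDeRhamCohomology.map EX (e z hz).contMDiff k)) ∧
      (∀ β : cclosedSmoothForms EX (X ((extChartAt 𝓘(ℂ, EB) s₀).symm z)) (m + 1),
        (∀ (y : X ((extChartAt 𝓘(ℂ, EB) s₀).symm z)) (a b : ℕ), a + p ≤ finrank ℂ EX →
            typeProjAt a b (show EX [⋀^Fin (m + 1)]→L[ℝ] ℂ from
              (β : MForm 𝓘(ℝ, EX) (X ((extChartAt 𝓘(ℂ, EB) s₀).symm z)) ℂ (m + 1)) y) = 0) →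
        ∀ (σ : EB → complexDeRhamCohomology EX (X s₀) k) (a : EB → CL2SmoothForms o₀ k),
          Tendsto a (𝓝 z) (𝓝 (a z)) →
          (∀ᶠ q in 𝓝 z, ∃ hq : q ∈ ball (extChartAt 𝓘(ℂ, EB) s₀ s₀) r,
            ∃ (η : MForm 𝓘(ℝ, EX) (X ((extChartAt 𝓘(ℂ, EB) s₀).symm q)) ℂ k)
              (hη : η ∈ cclosedSmoothForms EX (X ((extChartAt 𝓘(ℂ, EB) s₀).symm q)) k),
              (∀ (y : X ((extChartAt 𝓘(ℂ, EB) s₀).symm q)) (r' s : ℕ), r' < p →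
                typeProjAt r' s (show EX [⋀^Fin k]→L[ℝ] ℂ from η y) = 0) ∧
              CL2SmoothForms.toForm o₀ (a q) = η.pullback 𝓘(ℝ, EX) (e q hq) ∧
              σ q = complexDeRhamCohomology.map EX (e q hq).contMDiff k
                (complexDeRhamCohomology.mk EX (X ((extChartAt 𝓘(ℂ, EB) s₀).symm q)) k ⟨η, hη⟩)) →
          DifferentiableAt ℂ (fun q ↦ ℓ β (σ q)) z) := by
  haveI : Fact (IsSmoothForm (riemannianVolumeForm o₀)) := ⟨hov₀⟩
  haveI : IsManifold 𝓘(ℝ, EB) ∞ B := isManifold_real_of_isManifold_complex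
  haveI : FiniteDimensional ℝ EB := FiniteDimensional.complexToReal EB
  haveI : IsContinuousRiemannianBundle EX (fun x : X s₀ ↦ TangentSpace 𝓘(ℝ, EX) x) :=
    isContinuousRiemannianBundle_of_isContMDiffRiemannianBundle 𝓘(ℝ, EX) ∞
  haveI : FiniteDimensional ℝ EX := FiniteDimensional.complexToReal EX
  have ho₀ : IsContinuousOrientation o₀ :=
    isContinuousOrientation_of_isSmoothForm_riemannianVolumeForm_holds o₀ hov₀
  have hb : (extChartAt 𝓘(ℂ, EB) s₀).symm z ∈ O := hbO z hz
  have hιb := hι _ hb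
  let ez := e z hz
  have hez : ez = e z hz := rfl
  -- the functionals `ℓ_β [θ] = ∫ θ ∧ (e z)^*β`
  have hγmem : ∀ β : cclosedSmoothForms EX (X ((extChartAt 𝓘(ℂ, EB) s₀).symm z)) (m + 1),
      (β : MForm 𝓘(ℝ, EX) (X ((extChartAt 𝓘(ℂ, EB) s₀).symm z)) ℂ (m + 1)).pullback 𝓘(ℝ, EX) ez ∈
        cclosedSmoothForms EX (X s₀) (m + 1) := fun β ↦
    pullback_mem_cclosedSmoothForms ez.contMDiff β.2
  choose ℓ hℓ using fun β : cclosedSmoothForms EX (X ((extChartAt 𝓘(ℂ, EB) s₀).symm z)) (m + 1) ↦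
    exists_linearMap_mk_eq_cintegral_wedge o₀ ho₀ hkm ⟨_, hγmem β⟩
  have hℓ' : ∀ β (θ : cclosedSmoothForms EX (X s₀) k),
      ℓ β (complexDeRhamCohomology.mk EX (X s₀) k θ) =
        cintegral o₀ (((θ : MForm 𝓘(ℝ, EX) (X s₀) ℂ k).wedge
          ((β : MForm 𝓘(ℝ, EX) (X ((extChartAt 𝓘(ℂ, EB) s₀).symm z)) ℂ (m + 1)).pullback 𝓘(ℝ, EX) ez)).castDeg hkm) :=
    fun β θ ↦ hℓ β θ
  refine ⟨ℓ, hℓ', fun v hv ↦ ?_, fun β hβF σ a ha hrep ↦ ?_⟩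
  · -- (sep)
    obtain ⟨θ, rfl⟩ := complexDeRhamCohomology.mk_surjective v
    exact mk_mem_map_hodgeFiltration_of_forall_cintegral_wedge_pullback_eq_zero o₀ gz oz hgz hozc
      hkm p hozv hPD ez hoe θ fun β hβ ↦ by rw [← hℓ' β θ]; exact hv β hβ
  · -- (diff)
    haveI : WedgeFacts 𝓘(ℝ, EX) (X s₀) ℂ := wedgeFacts_discharged _ _ ℂ
    have hU : IsOpen (ball (extChartAt 𝓘(ℂ, EB) s₀ s₀) r) := isOpen_ball
    have hΨ : ∀ q ∈ ball (extChartAt 𝓘(ℂ, EB) s₀ s₀) r, ∀ x,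
        ContMDiffAt (𝓘(ℝ, EB).prod 𝓘(ℝ, EX)) 𝓘(ℝ, E𝒳) ∞ (uncurry Φ) (q, x) := fun q hq x ↦
      (hΦs (q, x) ⟨hq, mem_univ x⟩).contMDiffAt ((hU.prod isOpen_univ).mem_nhds ⟨hq, mem_univ x⟩)
    -- the representative at `z`
    obtain ⟨hz', ηz, hηz, hηzF, haz, -⟩ := hrep.self_of_nhds
    have hηzs : IsSmoothForm ηz := ((mem_cclosedSmoothForms_iff _).1 hηz).1
    have hηzc : IsClosedForm ηz := ((mem_cclosedSmoothForms_iff _).1 hηz).2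
    -- the tube test form of `β` (previous theorem)
    obtain ⟨Ξ, hΞs, hΞι, hdΞ', hT⟩ := exists_tubeTestForm_chartBall hπ hι hbt hbO hΦs e he hΛs hΛΦ hz
      (k := k) p β hβF
    -- the submersion-geometric hypotheses of the type heart at `z`
    let proj : 𝒳 → EB := fun y ↦ extChartAt 𝓘(ℂ, EB) s₀ (ϖ y)
    have hproj : proj = fun y ↦ extChartAt 𝓘(ℂ, EB) s₀ (ϖ y) := rfl
    have hbs : (extChartAt 𝓘(ℂ, EB) s₀).symm z ∈ (chartAt EB s₀).source := by
      rw [← extChartAt_source (I := 𝓘(ℂ, EB)) s₀]; exact (extChartAt 𝓘(ℂ, EB) s₀).map_target (hbt hz)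
    have hprojℂ : ∀ x, MDifferentiableAt 𝓘(ℂ, E𝒳) 𝓘(ℂ, EB) proj (Φ z x) := fun x ↦ by
      have h1 : MDifferentiableAt 𝓘(ℂ, EB) 𝓘(ℂ, EB) (extChartAt 𝓘(ℂ, EB) s₀) (ϖ (Φ z x)) := by
        rw [hπΦ z hz x]; exact mdifferentiableAt_extChartAt hbs
      exact h1.comp (Φ z x) (hπ.contMDiff.mdifferentiableAt (by simp))
    have hπΨ : ∀ q ∈ ball (extChartAt 𝓘(ℂ, EB) s₀ s₀) r, ∀ x, proj (Φ q x) = q := fun q hq x ↦ by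
      simp only [hproj, hπΦ q hq x]
      exact (extChartAt 𝓘(ℂ, EB) s₀).right_inv (hbt hq)
    have hπd : ∀ x, MDifferentiableAt 𝓘(ℝ, E𝒳) 𝓘(ℝ, EB) proj (Φ z x) := fun x ↦
      (hprojℂ x).real_of_complex
    have hπℂ : ∀ x (v : E𝒳), mfderiv 𝓘(ℝ, E𝒳) 𝓘(ℝ, EB) proj (Φ z x) (I • v) =
        I • (show EB from mfderiv 𝓘(ℝ, E𝒳) 𝓘(ℝ, EB) proj (Φ z x) v) := fun x v ↦
      mfderiv_real_apply_smul (hprojℂ x) I v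
    have hιφ : ι ((extChartAt 𝓘(ℂ, EB) s₀).symm z) ∘ ez = Φ z := funext fun x ↦ he z hz x
    have hιℂ : ∀ y (v : EX), mfderiv 𝓘(ℝ, EX) 𝓘(ℝ, E𝒳) (ι ((extChartAt 𝓘(ℂ, EB) s₀).symm z)) y (I • v) =
        I • (show E𝒳 from mfderiv 𝓘(ℝ, EX) 𝓘(ℝ, E𝒳) (ι ((extChartAt 𝓘(ℂ, EB) s₀).symm z)) y v) := fun y v ↦
      mfderiv_real_apply_smul (hιb.contMDiff.mdifferentiableAt (by simp)) I v
    have hcinj : Injective (mfderiv 𝓘(ℝ, EB) 𝓘(ℝ, EB) (extChartAt 𝓘(ℂ, EB) s₀) ((extChartAt 𝓘(ℂ, EB) s₀).symm z)) :=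
      injective_mfderiv_real_extChartAt s₀ ((extChartAt 𝓘(ℂ, EB) s₀).map_target (hbt hz))
    have hker : ∀ x (w : E𝒳), mfderiv 𝓘(ℝ, E𝒳) 𝓘(ℝ, EB) proj (Φ z x) w = 0 →
        mfderiv 𝓘(ℝ, E𝒳) 𝓘(ℝ, EB) ϖ (Φ z x) w = 0 := by
      intro x w hw
      have hπdr : MDifferentiableAt 𝓘(ℝ, E𝒳) 𝓘(ℝ, EB) ϖ (Φ z x) :=
        MDifferentiableAt.real_of_complex (hπ.contMDiff.mdifferentiableAt (by simp))
      have hcd : MDifferentiableAt 𝓘(ℝ, EB) 𝓘(ℝ, EB) (extChartAt 𝓘(ℂ, EB) s₀) (ϖ (Φ z x)) := by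
        rw [hπΦ z hz x]
        exact MDifferentiableAt.real_of_complex (mdifferentiableAt_extChartAt hbs)
      have hcomp : mfderiv 𝓘(ℝ, E𝒳) 𝓘(ℝ, EB) proj (Φ z x) =
          (mfderiv 𝓘(ℝ, EB) 𝓘(ℝ, EB) (extChartAt 𝓘(ℂ, EB) s₀) (ϖ (Φ z x))).comp (mfderiv 𝓘(ℝ, E𝒳) 𝓘(ℝ, EB) ϖ (Φ z x)) :=
        mfderiv_comp (Φ z x) hcd hπdr
      rw [hcomp] at hw
      rw [hπΦ z hz x] at hw
      apply hcinj
      rw [map_zero]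
      exact hw
    have hvert : ∀ x (w : E𝒳), mfderiv 𝓘(ℝ, E𝒳) 𝓘(ℝ, EB) proj (Φ z x) w = 0 →
        ∃ w' : EX, mfderiv 𝓘(ℝ, EX) 𝓘(ℝ, E𝒳) (ι ((extChartAt 𝓘(ℂ, EB) s₀).symm z)) (ez x) w' = w := by
      intro x w hw
      have hw' := hker x w hw
      rw [← he z hz x] at hw'
      exact exists_mfderiv_eq_of_mfderiv_proj_eq_zero hπ hιb hdim (ez x) w hw'
    have hηzF' : ∀ y a' b, a' + (finrank ℂ EX + 1 - p) ≤ finrank ℂ EX →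
        typeProjAt a' b (show EX [⋀^Fin k]→L[ℝ] ℂ from ηz y) = 0 :=
      fun y a' b hab ↦ hηzF y a' b (by omega)
    -- K5c: `q ↦ ∫ a(q) ∧ Φ_q^*Ξ` is complex differentiable at `z`
    have hK := differentiableAt_complex_cintegral_wedge_pullback_family_of_tendsto (o := o₀) hov₀ hU hz
      hΨ hπΨ hπd hπℂ hιφ hιb.contMDiff_real ez.contMDiff hιℂ hvert hkm (Fact.out) hΞs hΞι hdΞ'
      hηzs hηzc hηzF' a ha haz
    -- the identity `ℓ_β (σ q) = ∫ a(q) ∧ Φ_q^*Ξ` near `z`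
    have hev : (fun q ↦ ℓ β (σ q)) =ᶠ[𝓝 z] fun q ↦ cintegral o₀
        (((CL2SmoothForms.toForm o₀ (a q)).wedge (Ξ.pullback 𝓘(ℝ, EX) (Φ q))).castDeg hkm) := by
      filter_upwards [hrep, hT] with q hq hqT
      obtain ⟨hqD, ηq, hηq, hηqF, haq, hσq⟩ := hq
      -- `σ q = [a q]`
      have hcl : CL2SmoothForms.toForm o₀ (a q) ∈ cclosedSmoothForms EX (X s₀) k := by
        rw [haq]; exact pullback_mem_cclosedSmoothForms (e q hqD).contMDiff hηq
      have hσ' : σ q = complexDeRhamCohomology.mk EX (X s₀) k ⟨_, hcl⟩ := by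
        rw [hσq, complexDeRhamCohomology.map_mk]
        congr 1
        exact Subtype.ext haq.symm
      rw [hσ', hℓ' β]
      obtain ⟨hqD', hid⟩ := hqT
      change cintegral o₀ (((CL2SmoothForms.toForm o₀ (a q)).wedge
          ((β : MForm 𝓘(ℝ, EX) (X ((extChartAt 𝓘(ℂ, EB) s₀).symm z)) ℂ (m + 1)).pullback
            𝓘(ℝ, EX) ez)).castDeg hkm) = _
      rw [haq, hid ηq hηqF]
    exact hK.congr_of_eventuallyEq hev

end ChartBall

end Literature.AlgebraicGeometry.HodgeTheory
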